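import Literature.AlgebraicTopology.Homotopy.SurfaceFibrationCupGeneration
import Literature.AlgebraicTopology.Homotopy.LocallyTrivialFibrewiseSpan
import Literature.AlgebraicTopology.SingularHomology.HardLefschetzCapForm
import Literature.AlgebraicTopology.SingularHomology.CompactManifoldFiniteness
import Literature.AlgebraicGeometry.HodgeTheory.AndreottiFrankelHomotopyType
import Literature.AlgebraicGeometry.HodgeTheory.HyperplaneSectionMonodromyTrivialisations
import Literature.AlgebraicGeometry.Motives.SmoothProperLocallyTrivial
import Literature.AlgebraicGeometry.Motives.ComplexPointsManifold
import Literature.Geometry.Manifold.CircleSubmersionConnectedFibres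
import Literature.NumberTheory.Transcendental.AnalytificationConnectedProofs
import HarnessLib

/-!
# `H⁴(𝒱(ℂ)) = η ⌣ H² + Σ_i ζ_i ⌣ H²` for a smooth projective surface family over a smooth affine surface

Topic `Literature/AlgebraicGeometry/HodgeTheory`, towards the named fact
`Arapura2022_thm_1_2_smoothPart_pgZeroSurfaceFibration` (`ArapuraSurfaceFibredFourfoldsSplit.lean`,
the `V`-part of D. Arapura, *Hodge cycles and the Leray filtration*, Pacific J. Math. **319** (2022),
Cor. 1.5). The reduction `…_of_map_mem_span_cupProduct` (`ArapuraSurfaceFibredFourfoldsSplitProofs.lean`)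
isolated as its hypothesis `hI` the topological heart of the printed proof: on the smooth part
`V' = f'⁻¹U' → U'` of the base-changed family (a smooth projective morphism onto a smooth AFFINE
surface `U'`), `H⁴(V'(ℂ); ℂ) = h ∪ H²(V'(ℂ)) + Σ_i [𝒵_i] ∪ H²(V'(ℂ))` — in the paper: the Leray
spectral sequence of `V' → U'` degenerates (Deligne), `Hᵖ(U', R^{4-p}) = 0` for `p > 2`
(Andreotti–Frankel), `∪h : R¹ ≅ R³` and `∪h² : R⁰ ≅ R⁴` (hard Lefschetz on the surface fibres; Thm.
1.2, proof, first reflection) and `H²(U', R²f'_*ℚ) ≅ ⊕_i H²(U', ℚ) ∪ [𝒵_i]` because the relative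
divisor classes `[𝒵_i]` form a basis of the local system `R²f'_*ℚ` (proof of Cor. 1.5).

This file proves that statement, Leray-free, for an arbitrary smooth proper family
`π : 𝒱 ⟶ U` of smooth projective surfaces over a smooth affine connected surface `U` and classes
`η, ζ_i ∈ H²(𝒱(ℂ); ℂ)` (`exists_eq_cupProduct_add_sum_of_smooth_proper_family`): IF `η` restricted
to every fibre `𝒱_s(ℂ)` has the hard Lefschetz property in dimension `2` (for `η` the pull-back
of a generator of `H²(ℙᴺ(ℂ); ℂ)` under a projective embedding this is the tree's
`hasHardLefschetzProperty_map_of_forall_eq_smul` on each fibre) and the `ζ_i` restricted to ONE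
fibre `𝒱_{s₀}(ℂ)` span its `H²` (for the `[𝒵_i]` of the proof of Cor. 1.5: Lefschetz `(1,1)` and
`p_g = 0`), THEN every class of `H⁴(𝒱(ℂ); ℂ)` is `η ∪ w + Σ_i ζ_i ∪ u_i`. Assembly of PROVED tree
results: Ehresmann (`Motives.isLocallyTrivialFibration_map_of_smooth_proper`: `π(ℂ)` is a locally
trivial fibration, hence a fibre bundle over the connected base,
`Geometry.Manifold.isFibreBundleWith_of_isLocallyTrivialFibration`; connectedness of `U(ℂ)`, SGA1
XII 2.4, `Motives.ComplexPoints.connectedSpace_iff_holds`); the scheme-theoretic fibres ARE the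
topological fibres (`fiberHomeomorph`), which are closed real `4`-manifolds with finite homology
(`finite_singularHomology_of_compactSpace_holds`, `Motives.ComplexPoints.isZero_singularHomology_of_lt`);
Andreotti–Frankel in homotopy form on the sublevel sets of `U(ℂ)`
(`AffineCoordinates.exists_sublevels_homotopyEquiv_cwComplex_of_isAffine`); propagation of fibrewise
spanning over the connected base (`IsLocallyTrivialFibration.span_map_fibre_eq_top`); hard Lefschetz
in cap form (`bijective_iterDown_capProduct_of_hasHardLefschetzProperty`); and the topological
generation theorem `Homotopy.exists_eq_cupProduct_add_sum_of_fibrewise` (Serre skeletal filtration,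
cap-product Lefschetz endomorphism of its exact couple, Milnor–Mittag-Leffler over the exhaustion).
Everything is proved; no definition and no named fact is introduced (D-0026).

## References

* D. Arapura, *Hodge cycles and the Leray filtration*, Pacific J. Math. 319 (2022) 233–258
  (arXiv:2103.05038), Thm. 1.2 (proof, first reflection) and proof of Cor. 1.5 (p. 5). [Arapura2022]
* C. Voisin, *Hodge Theory and Complex Algebraic Geometry II*, CUP (2003), §1.2.2 Thm. 1.22,
  Lemma 4.13, Thm. 4.15 (proof). [VoisinHodgeII2003]
* C. Voisin, *Hodge Theory and Complex Algebraic Geometry I*, CUP (2002), Thm. 9.3 (Ehresmann).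
  [VoisinHodgeI2002]
* A. Hatcher, *Algebraic Topology*, CUP (2002), §3.1 p. 201, §3.3, §4.2. [HatcherAT2002]
-/

noncomputable section

open Set Function CategoryTheory AlgebraicGeometry Topology
open Literature.AlgebraicTopology.SingularHomology Literature.AlgebraicTopology.Homotopy
open Literature.Algebra.Homology Literature.Geometry.Kaehler

namespace Literature.AlgebraicGeometry.HodgeTheory

section HodgeTheory

/-- Spanning families stay spanning under a surjective linear map (local copy). [folklore] -/
private theorem span_range_comp_eq_top' {K : Type*} [CommRing K] {M N : Type*} [AddCommGroup M]
    [Module K M] [AddCommGroup N] [Module K N] {ι : Type*} {v : ι → M} (f : M →ₗ[K] N)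
    (hf : Surjective f) (hv : Submodule.span K (Set.range v) = ⊤) :
    Submodule.span K (Set.range (f ∘ v)) = ⊤ := by
  rw [Set.range_comp, Submodule.span_image, hv, Submodule.map_top, LinearMap.range_eq_top.2 hf]

variable {𝒱 U : Motives.SchemeOver ℂ} (π : 𝒱 ⟶ U)

/-- **`H⁴(𝒱(ℂ); ℂ) = η ⌣ H²(𝒱(ℂ); ℂ) + Σ_i ζ_i ⌣ H²(𝒱(ℂ); ℂ)` for a smooth proper family of
smooth projective surfaces over a smooth affine connected surface** — the topological statement
behind Arapura's proof of Cor. 1.5 (with Thm. 1.2, proof, first reflection: the Leray spectral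
sequence of `V' → U'`, `∪h : R¹ ≅ R³`, `R⁴ = ℚh²`, Andreotti–Frankel on the affine `U'`, and
"`[𝒵_1], …, [𝒵_N]` gives a basis of `R²f_*ℚ` … `H²(U, R²f_*ℚ) ≅ ⊕_i H²(U, ℚ) ∪ [𝒵_i]`"), in
Leray-free form and for arbitrary classes. Hypotheses: `π : 𝒱 ⟶ U` smooth and proper, `U` affine,
connected, smooth of dimension `2` over `ℂ`; the fibre `𝒱_{s₀}` a smooth projective surface (so are all
fibres in the application); `η`
has the hard Lefschetz property in dimension `2` on every fibre (e.g. `η` the pull-back of a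
generator of `H²(ℙᴺ(ℂ); ℂ)`, `hasHardLefschetzProperty_map_of_forall_eq_smul`); the `ζ_i` span
`H²` of ONE fibre. Conclusion: every `c ∈ H⁴(𝒱(ℂ); ℂ)` is `η ∪ w + Σ_i ζ_i ∪ u_i`.
[cite: Arapura2022, Thm. 1.2 (proof, first reflection) and proof of Cor. 1.5 (p. 5)]
[cite: VoisinHodgeII2003, Thm. 1.22, Lemma 4.13 and Thm. 4.15 (proof)]
[cite: VoisinHodgeI2002, Thm. 9.3] [cite: HatcherAT2002, §3.1 p. 201, §3.3 p. 241, §4.2 p. 376] -/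
theorem exists_eq_cupProduct_add_sum_of_smooth_proper_family
    [IsAffine U.left] [ConnectedSpace U.left] [SmoothOfRelativeDimension 2 U.hom]
    [IsSeparated U.hom] [Smooth π.left] [IsProper π.left]
    (η : singularCohomology ℂ ℂ (Motives.ComplexPoints 𝒱) 2) {ι : Type} [Fintype ι]
    (ζ : ι → singularCohomology ℂ ℂ (Motives.ComplexPoints 𝒱) 2)
    (hHL : ∀ s : Motives.ComplexPoints U, HasHardLefschetzProperty
      (singularCohomology.map ℂ ℂ
        (Motives.AlgPoints.mapContinuous (L := ℂ) (Motives.fiberι π s)) 2 η) 2)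
    {s₀ : Motives.ComplexPoints U} (hfib : Motives.IsSmoothProjective 2 (Motives.fiberOver π s₀))
    (hspan : Submodule.span ℂ (Set.range fun i => singularCohomology.map ℂ ℂ
      (Motives.AlgPoints.mapContinuous (L := ℂ) (Motives.fiberι π s₀)) 2 (ζ i)) = ⊤)
    (c : singularCohomology ℂ ℂ (Motives.ComplexPoints 𝒱) 4) :
    ∃ (w : singularCohomology ℂ ℂ (Motives.ComplexPoints 𝒱) 2)
      (u : ι → singularCohomology ℂ ℂ (Motives.ComplexPoints 𝒱) 2),
      c = cupProduct (show 2 + 2 = 4 by rfl) η w +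
        ∑ i, cupProduct (show 2 + 2 = 4 by rfl) (ζ i) (u i) := by
  classical
  -- instances on the base and the total space
  haveI : Smooth U.hom := SmoothOfRelativeDimension.smooth (n := 2) (f := U.hom)
  haveI : LocallyOfFiniteType U.hom := inferInstance
  haveI : IsSeparated 𝒱.hom := by rw [← Over.w π]; infer_instance
  haveI : ConnectedSpace (Motives.ComplexPoints U) :=
    (Motives.ComplexPoints.connectedSpace_iff_holds U).2 inferInstance
  haveI : LocallyPathConnectedSpace (Motives.ComplexPoints U) := by
    letI := Motives.ComplexPoints.chartedSpace U 2
    exact ChartedSpace.locallyPathConnectedSpace (EuclideanSpace ℝ (Fin (2 * 2)))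
      (Motives.ComplexPoints U)
  -- Ehresmann: `π(ℂ)` is a locally trivial fibration, hence a bundle with fibre `π(ℂ)⁻¹(s₀)`
  have hlt : IsLocallyTrivialFibration (Motives.AlgPoints.map π) :=
    Motives.isLocallyTrivialFibration_map_of_smooth_proper π
  have hbundle : IsFibreBundleWith ↥(Motives.AlgPoints.map π ⁻¹' {s₀}) (Motives.AlgPoints.map π) :=
    Literature.Geometry.Manifold.isFibreBundleWith_of_isLocallyTrivialFibration
      (Motives.AlgPoints.continuous_map π) hlt s₀
  -- the scheme-theoretic fibres are the topological fibres (`fiberHomeomorph`)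
  have hecomp : ∀ s : Motives.ComplexPoints U, (subsetIncl (Motives.AlgPoints.map π ⁻¹' {s})).comp
      (fiberHomeomorph π s : C(Motives.ComplexPoints (Motives.fiberOver π s),
        ↥(Motives.AlgPoints.map π ⁻¹' {s}))) =
      Motives.AlgPoints.mapContinuous (L := ℂ) (Motives.fiberι π s) := fun s =>
    ContinuousMap.ext fun x => coe_fiberHomeomorph_apply π s x
  have hclass : ∀ (s : Motives.ComplexPoints U) (a : singularCohomology ℂ ℂ (Motives.ComplexPoints 𝒱) 2),
      singularCohomology.map ℂ ℂ
          (fiberHomeomorph π s : C(Motives.ComplexPoints (Motives.fiberOver π s),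
            ↥(Motives.AlgPoints.map π ⁻¹' {s}))) 2
        (singularCohomology.map ℂ ℂ (subsetIncl (Motives.AlgPoints.map π ⁻¹' {s})) 2 a) =
      singularCohomology.map ℂ ℂ
        (Motives.AlgPoints.mapContinuous (L := ℂ) (Motives.fiberι π s)) 2 a := fun s a => by
    rw [← ModuleCat.comp_apply, ← singularCohomology.map_comp, hecomp]
  have hbijH : ∀ (s : Motives.ComplexPoints U) (q : ℕ), Bijective (singularHomology.map ℂ ℂ
      (fiberHomeomorph π s : C(Motives.ComplexPoints (Motives.fiberOver π s),
        ↥(Motives.AlgPoints.map π ⁻¹' {s}))) q).hom := fun s q =>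
    (singularHomology.mapIso ℂ ℂ (fiberHomeomorph π s) q).toLinearEquiv.bijective
  -- finiteness of the homology of the fibre (a closed real `4`-manifold)
  have hF : FinRelHomology ℂ ℂ ↥(Motives.AlgPoints.map π ⁻¹' {s₀}) ∅ 5 := by
    have h1 : FinRelHomology ℂ ℂ (Motives.ComplexPoints (Motives.fiberOver π s₀)) ∅ 5 := by
      letI := hfib.chartedSpace
      haveI := Motives.ComplexPoints.compactSpace_of_isSmoothProjective hfib
      haveI := Motives.ComplexPoints.t2Space_of_isSmoothProjective hfib
      exact FinRelHomology.empty_of_absolute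
        (fun j => finite_singularHomology_of_compactSpace_holds ℂ
          (Motives.ComplexPoints (Motives.fiberOver π s₀)) (2 * 2) j)
        (fun _ hj => Motives.ComplexPoints.isZero_singularHomology_of_lt hfib ℂ ℂ (by omega))
    exact h1.of_homeomorph (fiberHomeomorph π s₀) (Set.mapsTo_empty _ _) (Set.mapsTo_empty _ _)
  -- Andreotti–Frankel on the smooth affine surface `U`
  haveI : SmoothOfRelativeDimension (1 + 1) U.hom := ‹SmoothOfRelativeDimension 2 U.hom›
  obtain ⟨f, hf, -, hCW⟩ :=
    AffineCoordinates.exists_sublevels_homotopyEquiv_cwComplex_of_isAffine (k := 1) U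
  -- spanning on the topological fibre over `s₀`, then over every `s`
  have hspan₀ : Submodule.span ℂ (Set.range fun i =>
      singularCohomology.map ℂ ℂ (subsetIncl (Motives.AlgPoints.map π ⁻¹' {s₀})) 2 (ζ i)) = ⊤ := by
    have hfam : (fun i => singularCohomology.map ℂ ℂ
        (subsetIncl (Motives.AlgPoints.map π ⁻¹' {s₀})) 2 (ζ i)) =
        (singularCohomology.map ℂ ℂ ((fiberHomeomorph π s₀).symm :
            C(↥(Motives.AlgPoints.map π ⁻¹' {s₀}), Motives.ComplexPoints (Motives.fiberOver π s₀)))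
          2).hom ∘
        (fun i => singularCohomology.map ℂ ℂ
          (Motives.AlgPoints.mapContinuous (L := ℂ) (Motives.fiberι π s₀)) 2 (ζ i)) := by
      funext i
      show _ = (singularCohomology.map ℂ ℂ ((fiberHomeomorph π s₀).symm :
            C(↥(Motives.AlgPoints.map π ⁻¹' {s₀}), Motives.ComplexPoints (Motives.fiberOver π s₀)))
          2).hom (singularCohomology.map ℂ ℂ
            (Motives.AlgPoints.mapContinuous (L := ℂ) (Motives.fiberι π s₀)) 2 (ζ i))
      rw [← hclass s₀ (ζ i)]
      change _ = ((singularCohomology.mapIso ℂ ℂ (fiberHomeomorph π s₀) 2).hom ≫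
        (singularCohomology.mapIso ℂ ℂ (fiberHomeomorph π s₀) 2).inv) _
      rw [Iso.hom_inv_id]
      rfl
    rw [hfam]
    exact span_range_comp_eq_top' _
      (singularCohomology.mapIso ℂ ℂ (fiberHomeomorph π s₀) 2).symm.toLinearEquiv.surjective hspan
  have hspanAll : ∀ s : Motives.ComplexPoints U, Submodule.span ℂ (Set.range fun i =>
      singularCohomology.map ℂ ℂ (subsetIncl (Motives.AlgPoints.map π ⁻¹' {s})) 2 (ζ i)) = ⊤ :=
    hlt.span_map_fibre_eq_top ℂ ζ hspan₀
  -- the topological generation theorem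
  refine exists_eq_cupProduct_add_sum_of_fibrewise ℂ hbundle hF hf (fun b => ?_) η ζ
    (fun s lo i hloi _ => ?_) (fun s y hy => ?_) c
  · obtain ⟨a, hba, C, tC, t2C, cwC, hfin, hdim, hC⟩ := hCW b
    exact ⟨a, hba, C, tC, t2C, cwC, hfin, fun m hm => hdim m (by omega), hC⟩
  · -- hard Lefschetz in cap form on `π(ℂ)⁻¹(s) ≅ 𝒱_s(ℂ)`
    refine (bijective_iterDown_capProduct_map_iff ℂ
      (fiberHomeomorph π s : C(Motives.ComplexPoints (Motives.fiberOver π s),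
        ↥(Motives.AlgPoints.map π ⁻¹' {s}))) (hbijH s) _ i lo).1 ?_
    rw [hclass s η]
    exact bijective_iterDown_capProduct_of_hasHardLefschetzProperty ℂ _ (hHL s) hloi
  · -- the restricted `ζ_i` span `H²` of the fibre, hence detect `H₂`
    exact eq_zero_of_forall_capProduct_eq_zero_of_span ℂ
      (fun i => singularCohomology.map ℂ ℂ (subsetIncl (Motives.AlgPoints.map π ⁻¹' {s})) 2 (ζ i))
      (hspanAll s) y (fun i => hy i)

end HodgeTheory

end Literature.AlgebraicGeometry.HodgeTheory

end
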